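import Summits.KontsevichZagierPeriods.KontsevichZagierPeriods.Theses.TorsionLogs
import Summits.KontsevichZagierPeriods.KontsevichZagierPeriods.Theorems.TorsionLogsNeronTorsionSector

/-!
# WITNESS (F3 / BC5) for the rung `NeronDistribution` — the floor IS the member `regular = false`

`neronDistributionMember_false : NeronDistributionMember false` (sorry-free) from the SEED
`Summit.KontsevichZagierPeriods.KontsevichZagierPeriods.Cruxes.NeronTorsionSector.Translation.stub_assembly`
(= `Theses.TorsionLogs.NeronTorsionPrimitiveChain_holds`, item stmt-KontsevichZagierPeriods-17981).
At `x_Q = e₁` the point `Q = n • P` is the 2-torsion point `T = (e₁, 0)`, so `2n • P = 0`: `P` is torsion of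
order `N ≥ 3` (`N ∣ 2n`, `N ≠ 1, 2` because `P` is affine with `y_P ≠ 0`); the sheet datum
`ω₁/2 = εn·U_P + k·ω₁` and the floor's torsion parameter `N·U_P = a·ω₁` give `N(1 − 2k) = 2εna`, the real
dictionary (`stub_realDictionary`) gives `0 < U_P < ω₁/2`, whence `0 < a`, `2a < N`; with
`p/q = (N − 2a)/(2N)` in lowest terms, `2n = g·q` and `μ = −ε·g·p` (`g ∈ ℕ`); the representations `rI_Q`, `rR_Q`
have EMPTY domains, so the tied distribution element is `−g²·(q²[rI_P] + p²[rP])` — the floor's element times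
`−g²` — and the floor's carrier is exchanged for the given one by the landed exact log relation
`interval_log_relation_mem_relations`. Self-contained: verbatim copies of the two `def`s of
`Lines/NeronDistribution.lean` in the namespace `…NeronDistribution.Special`.
-/

open Set MeasureTheory
open Literature.NumberTheory.Transcendental Literature.ModelTheory.ExponentialFields
open Summit.KontsevichZagierPeriods.HyperbolicBloch.OffTetraSectorKernel (interval_log_relation_mem_relations)
open Summit.KontsevichZagierPeriods.KontsevichZagierPeriods.Cruxes.NeronTorsionSector.Translation
  (stub_assembly stub_realDictionary logRep_value isAlgebraic_endpoints_of_isSemialgebraic_Ioo)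

namespace Summit.KontsevichZagierPeriods.KontsevichZagierPeriods.Cruxes.TorsionSectorComplete.NeronDistribution.Special

/-- MEMBER (verbatim copy of `Lines/NeronDistribution.lean`). -/
def NeronDistributionMember (regular : Bool) : Prop :=
  ∀ (g₂ g₃ e₁ xP yP xQ yQ B : ℝ) (N a n : ℕ) (ε k μ c : ℤ) (f : ℝ → ℝ),
    (∀ x, f x = 4 * x ^ 3 - g₂ * x - g₃) → g₂ ^ 3 - 27 * g₃ ^ 2 ≠ 0 → f e₁ = 0 → 0 < e₁ →
    (∀ x, e₁ < x → 0 < f x) → e₁ < xP → yP ^ 2 = f xP →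
    (∀ hns : (⟨0, 0, 0, -g₂ / 4, -g₃ / 4⟩ : WeierstrassCurve ℝ).toAffine.Nonsingular xP (yP / 2),
      addOrderOf (WeierstrassCurve.Affine.Point.some xP (yP / 2) hns) = N) →
    (N : ℝ) * (∫ x in Set.Ioi xP, (Real.sqrt (f x))⁻¹) = a * (2 * ∫ x in Set.Ioi e₁, (Real.sqrt (f x))⁻¹) →
    2 ≤ n → (if regular then e₁ < xQ else xQ = e₁) → yQ ^ 2 = f xQ →
    (∀ (hnsP : (⟨0, 0, 0, -g₂ / 4, -g₃ / 4⟩ : WeierstrassCurve ℝ).toAffine.Nonsingular xP (yP / 2))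
       (hnsQ : (⟨0, 0, 0, -g₂ / 4, -g₃ / 4⟩ : WeierstrassCurve ℝ).toAffine.Nonsingular xQ (yQ / 2)),
      n • WeierstrassCurve.Affine.Point.some xP (yP / 2) hnsP =
        WeierstrassCurve.Affine.Point.some xQ (yQ / 2) hnsQ) →
    (ε = 1 ∨ ε = -1) →
    (∫ x in Set.Ioi xQ, (Real.sqrt (f x))⁻¹) =
      ε * n * (∫ x in Set.Ioi xP, (Real.sqrt (f x))⁻¹) + k * (2 * ∫ x in Set.Ioi e₁, (Real.sqrt (f x))⁻¹) →
    μ = 1 - ε * n - 2 * k →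
    ∀ (rIP rIQ rRQ rP : Literature.NumberTheory.Transcendental.KZ.IntegralRep 2)
      (rB : Literature.NumberTheory.Transcendental.KZ.IntegralRep 1),
    rIP.domain = {z | e₁ < z 1 ∧ z 1 < z 0 ∧ z 0 < xP} →
    Set.EqOn rIP.integrand (fun z => z 1 / (Real.sqrt (f (z 1)) * Real.sqrt (f (z 0)))) rIP.domain →
    rIQ.domain = {z | e₁ < z 1 ∧ z 1 < z 0 ∧ z 0 < xQ} →
    Set.EqOn rIQ.integrand (fun z => z 1 / (Real.sqrt (f (z 1)) * Real.sqrt (f (z 0)))) rIQ.domain →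
    rRQ.domain = {z | e₁ < z 0 ∧ z 0 < xQ ∧ e₁ < z 1} →
    Set.EqOn rRQ.integrand
      (fun z => (Real.sqrt (f (z 0)))⁻¹ * ((g₂ * z 1 + 2 * g₃) / (2 * (z 1) ^ 2 * Real.sqrt (f (z 1))))) rRQ.domain →
    rP.domain = {z | e₁ < z 0 ∧ e₁ < z 1} →
    Set.EqOn rP.integrand
      (fun z => (Real.sqrt (f (z 0)))⁻¹ * ((g₂ * z 1 + 2 * g₃) / (2 * (z 1) ^ 2 * Real.sqrt (f (z 1))))) rP.domain →
    1 < B → rB.domain = {t | 1 < t 0 ∧ t 0 < B} → Set.EqOn rB.integrand (fun t => (t 0)⁻¹) rB.domain →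
    4 * rIQ.value - 4 * (n : ℝ) ^ 2 * rIP.value + 2 * (μ : ℝ) * rRQ.value - (μ : ℝ) ^ 2 * rP.value = c * rB.value →
    (4 : ℤ) • Literature.NumberTheory.Transcendental.KZ.of rIQ
      - ((4 * n ^ 2 : ℕ) : ℤ) • Literature.NumberTheory.Transcendental.KZ.of rIP
      + (2 * μ) • Literature.NumberTheory.Transcendental.KZ.of rRQ
      - (μ ^ 2) • Literature.NumberTheory.Transcendental.KZ.of rP
      - c • Literature.NumberTheory.Transcendental.KZ.of rB ∈ Literature.NumberTheory.Transcendental.KZ.relations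

/-- THE RUNG (verbatim copy). -/
def NeronDistribution : Prop := ∀ regular : Bool, NeronDistributionMember regular

/-- Instantiation: every member from the rung. -/
theorem member_of_rung (h : NeronDistribution) (regular : Bool) : NeronDistributionMember regular := h regular

/-- The discriminant of the Weierstrass model `Y² = X³ − (g₂/4)X − g₃/4` is `g₂³ − 27g₃²`. [folklore] -/
theorem curve_Δ (g₂ g₃ : ℝ) :
    (⟨0, 0, 0, -g₂ / 4, -g₃ / 4⟩ : WeierstrassCurve ℝ).toAffine.Δ = g₂ ^ 3 - 27 * g₃ ^ 2 := by
  simp only [WeierstrassCurve.Δ, WeierstrassCurve.b₂, WeierstrassCurve.b₄, WeierstrassCurve.b₆,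
    WeierstrassCurve.b₈]
  ring

/-- A real point `(x, y/2)` with `y² = 4x³ − g₂x − g₃`, `Δ ≠ 0`, is nonsingular. [folklore] -/
theorem curve_nonsingular {g₂ g₃ x y : ℝ} (hΔ : g₂ ^ 3 - 27 * g₃ ^ 2 ≠ 0) (f : ℝ → ℝ)
    (hf : ∀ x, f x = 4 * x ^ 3 - g₂ * x - g₃) (hy : y ^ 2 = f x) :
    (⟨0, 0, 0, -g₂ / 4, -g₃ / 4⟩ : WeierstrassCurve ℝ).toAffine.Nonsingular x (y / 2) := by
  refine (WeierstrassCurve.Affine.equation_iff_nonsingular_of_Δ_ne_zero ?_).mp ?_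
  · rw [curve_Δ]; exact hΔ
  · rw [WeierstrassCurve.Affine.equation_iff]
    have h := hy
    rw [hf] at h
    dsimp only
    linear_combination (1 / 4 : ℝ) * h

set_option maxHeartbeats 1600000 in
/-- **WITNESS (F3): the member `regular = false` holds — it is the floor `stub_assembly` times `−g²`.**
[cite: KontsevichZagier2001, §1.2] -/
theorem neronDistributionMember_false : NeronDistributionMember false := by
  intro g₂ g₃ e₁ xP yP xQ yQ B N a n ε k μ c f hf hΔ he₁ he₁pos hfpos hxP hyP hord htor hn hxQ hyQ hmul hε
    hsheet hμ rIP rIQ rRQ rP rB hIPd hIPi hIQd hIQi hRQd hRQi hPd hPi hB1 hBd hBi hval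
  have hxQe : xQ = e₁ := by simpa using hxQ
  subst hxQe
  have hyQ0 : yQ = 0 := by
    rw [he₁] at hyQ
    exact pow_eq_zero_iff (two_ne_zero) |>.mp hyQ
  subst hyQ0
  -- (1) the points `P` and `T = (e₁, 0)`; `n • P = T`, `2 • T = 0`, so `P` has finite order `N ≥ 3`
  have hnsP := curve_nonsingular hΔ f hf hyP
  have hnsT : (⟨0, 0, 0, -g₂ / 4, -g₃ / 4⟩ : WeierstrassCurve ℝ).toAffine.Nonsingular xQ ((0 : ℝ) / 2) :=
    curve_nonsingular hΔ f hf (by rw [he₁]; ring)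
  have hPT := hmul hnsP hnsT
  have h2T : (2 : ℕ) • WeierstrassCurve.Affine.Point.some xQ ((0 : ℝ) / 2) hnsT = 0 := by
    rw [two_nsmul]
    exact WeierstrassCurve.Affine.Point.add_self_of_Y_eq (by simp [WeierstrassCurve.Affine.negY])
  have h2nP : (2 * n) • WeierstrassCurve.Affine.Point.some xP (yP / 2) hnsP = 0 := by
    rw [mul_nsmul', hPT, h2T]
  have hN : addOrderOf (WeierstrassCurve.Affine.Point.some xP (yP / 2) hnsP) = N := hord hnsP
  have hNpos : 0 < N := by
    rw [← hN]
    exact (isOfFinAddOrder_iff_nsmul_eq_zero.mpr ⟨2 * n, by omega, h2nP⟩).addOrderOf_pos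
  have hN1 : N ≠ 1 := by
    intro h1
    rw [h1, AddMonoid.addOrderOf_eq_one_iff] at hN
    exact WeierstrassCurve.Affine.Point.some_ne_zero hnsP hN
  have hN2 : N ≠ 2 := by
    intro h2
    have h2P : (2 : ℕ) • WeierstrassCurve.Affine.Point.some xP (yP / 2) hnsP = 0 := by
      have h0 := addOrderOf_nsmul_eq_zero (WeierstrassCurve.Affine.Point.some xP (yP / 2) hnsP)
      rwa [hN, h2] at h0
    rw [two_nsmul, add_eq_zero_iff_eq_neg, WeierstrassCurve.Affine.Point.neg_some] at h2P
    have hy : yP / 2 = (⟨0, 0, 0, -g₂ / 4, -g₃ / 4⟩ : WeierstrassCurve ℝ).toAffine.negY xP (yP / 2) := by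
      simpa using h2P
    simp only [WeierstrassCurve.Affine.negY] at hy
    have hy0 : yP = 0 := by linarith
    have : f xP = 0 := by rw [← hyP, hy0]; ring
    exact (hfpos xP hxP).ne' this
  have hN3 : 3 ≤ N := by omega
  -- (2) the real dictionary: `0 < U_P < ω/2`
  obtain ⟨ω, X, Y, hω, hωint, -, -, -, -, -, -, -, -, -, -, hsurj, hint, -⟩ :=
    stub_realDictionary g₂ g₃ xQ f hf hΔ he₁ hfpos
  set Ω : ℝ := ∫ x in Set.Ioi xQ, (Real.sqrt (f x))⁻¹ with hΩ
  set UP : ℝ := ∫ x in Set.Ioi xP, (Real.sqrt (f x))⁻¹ with hUP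
  have hΩω : ω = 2 * Ω := hωint
  have hΩpos : 0 < Ω := by linarith
  obtain ⟨u, hu, hXu⟩ := hsurj xP hxP
  have hUPu : UP = u := by
    have h1 := hint u ⟨hu.1, hu.2.le⟩
    rw [hXu] at h1
    exact h1
  have hUPpos : 0 < UP := by rw [hUPu]; exact hu.1
  have hUPlt : UP < Ω := by rw [hUPu]; linarith [hu.2]
  -- (3) `0 < a`, `2a < N`, and the integer relation `N(1 − 2k) = 2εna`
  have hNr : (0 : ℝ) < N := by exact_mod_cast hNpos
  have ha : 0 < a := by
    rcases Nat.eq_zero_or_pos a with h0 | h0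
    · exfalso
      rw [h0] at htor
      have : (N : ℝ) * UP = 0 := by rw [htor]; push_cast; ring
      rcases mul_eq_zero.mp this with h | h
      · linarith
      · linarith
    · exact h0
  have haN : 2 * a < N := by
    have h1 : (a : ℝ) * (2 * Ω) < N * Ω := by
      rw [← htor]
      exact mul_lt_mul_of_pos_left hUPlt hNr
    have h2 : ((2 * a : ℕ) : ℝ) < N := by
      push_cast
      nlinarith
    exact_mod_cast h2
  have hrel : (N : ℤ) * (1 - 2 * k) = 2 * ε * n * a := by
    have h1 : (N : ℝ) * Ω = ε * n * ((N : ℝ) * UP) + 2 * k * ((N : ℝ) * Ω) := by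
      linear_combination (N : ℝ) * hsheet
    rw [htor] at h1
    have h2 : ((N : ℝ) * (1 - 2 * k) - 2 * ε * n * a) * Ω = 0 := by linear_combination h1
    rcases mul_eq_zero.mp h2 with h3 | h3
    · exact_mod_cast (sub_eq_zero.mp h3)
    · exact absurd h3 hΩpos.ne'
  -- (4) `p/q = (N − 2a)/(2N)` in lowest terms; `2n = g q`, `μ = −ε g p`
  set g₀ : ℕ := Nat.gcd (N - 2 * a) (2 * N) with hg₀
  have hg₀pos : 0 < g₀ := Nat.gcd_pos_of_pos_right _ (by omega)
  set p : ℕ := (N - 2 * a) / g₀ with hp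
  set q : ℕ := (2 * N) / g₀ with hq
  have hcop : Nat.Coprime p q := Nat.coprime_div_gcd_div_gcd hg₀pos
  have hp' : g₀ * p = N - 2 * a := Nat.mul_div_cancel' (Nat.gcd_dvd_left _ _)
  have hq' : g₀ * q = 2 * N := Nat.mul_div_cancel' (Nat.gcd_dvd_right _ _)
  have hqpos : 0 < q := by
    rcases Nat.eq_zero_or_pos q with h0 | h0
    · rw [h0, mul_zero] at hq'; omega
    · exact h0
  have hpz : (g₀ : ℤ) * p = (N : ℤ) - 2 * (a : ℤ) := by
    have := congrArg (fun t : ℕ => (t : ℤ)) hp'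
    push_cast [Nat.cast_sub (by omega : 2 * a ≤ N)] at this
    linarith
  have hqz : (g₀ : ℤ) * q = 2 * (N : ℤ) := by exact_mod_cast hq'
  have hqN : (q : ℤ) * ((N : ℤ) - 2 * (a : ℤ)) = (p : ℤ) * (2 * (N : ℤ)) := by
    rw [← hpz, ← hqz]; ring
  -- `μ q = −2 ε n p`
  have hε2 : ε ^ 2 = 1 := by rcases hε with h | h <;> simp [h]
  have hμq : μ * (q : ℤ) = -(2 * ε * (n : ℤ) * p) := by
    -- multiply `μ = 1 − εn − 2k` by `N q = ... `; use `N(1−2k) = 2εna`, `g₀ p = N − 2a`, `g₀ q = 2N`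
    have h1 : μ * (q : ℤ) * (g₀ : ℤ) = -(2 * ε * (n : ℤ) * p) * (g₀ : ℤ) := by
      have e1 : μ * (q : ℤ) * (g₀ : ℤ) = μ * (2 * N) := by rw [← hqz]; ring
      have e2 : -(2 * ε * (n : ℤ) * ↑p) * (g₀ : ℤ) = -(2 * ε * n) * ((N : ℤ) - 2 * a) := by rw [← hpz]; ring
      rw [e1, e2, hμ]
      linear_combination (2 : ℤ) * hrel
    have hg₀z : (g₀ : ℤ) ≠ 0 := by exact_mod_cast hg₀pos.ne'
    exact mul_right_cancel₀ hg₀z h1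
  -- `q ∣ 2n`
  have hqdvd : (q : ℤ) ∣ 2 * (n : ℤ) := by
    have hc : IsCoprime (q : ℤ) (p : ℤ) := Nat.isCoprime_iff_coprime.mpr hcop.symm
    have h1 : (q : ℤ) ∣ (p : ℤ) * (2 * ε * n) := ⟨-μ, by linear_combination hμq⟩
    have h2 : (q : ℤ) ∣ 2 * ε * n := hc.dvd_of_dvd_mul_left h1
    rcases hε with h | h
    · simpa [h] using h2
    · have : (q : ℤ) ∣ -(2 * ε * n) := (dvd_neg).mpr h2
      simpa [h] using this
  obtain ⟨g, hg⟩ := hqdvd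
  -- `μ = −ε g p`
  have hμg : μ = -(ε * g * p) := by
    have hqz0 : (q : ℤ) ≠ 0 := by exact_mod_cast hqpos.ne'
    have h1 : μ * (q : ℤ) = -(ε * g * p) * (q : ℤ) := by rw [hμq]; linear_combination (-ε * (p : ℤ)) * hg
    exact mul_right_cancel₀ hqz0 h1
  have h4n : ((4 * n ^ 2 : ℕ) : ℤ) = g ^ 2 * (q : ℤ) ^ 2 := by
    push_cast; linear_combination (2 * (n : ℤ) + (q : ℤ) * g) * hg
  have hμ2 : μ ^ 2 = g ^ 2 * (p : ℤ) ^ 2 := by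
    rw [hμg]; linear_combination (g ^ 2 * (p : ℤ) ^ 2) * hε2
  -- (5) the empty representations `rI_Q`, `rR_Q` are relations
  have hIQrel : KZ.of rIQ ∈ KZ.relations :=
    KZ.of_mem_relations_of_eqOn_zero rIQ fun t ht => by
      rw [hIQd] at ht
      obtain ⟨h1, h2, h3⟩ := ht
      linarith
  have hRQrel : KZ.of rRQ ∈ KZ.relations :=
    KZ.of_mem_relations_of_eqOn_zero rRQ fun t ht => by
      rw [hRQd] at ht
      obtain ⟨h1, h2, h3⟩ := ht
      linarith
  -- (6) the floor
  obtain ⟨c₀, B₀, rB₀, hB₀1, hB₀alg, hrB₀d, hrB₀i, hmem⟩ := stub_assembly g₂ g₃ xQ xP yP N a p q f hf hΔ he₁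
    he₁pos hfpos hxP hyP hN3 ha haN hord htor hcop hqN rIP rP hIPd hIPi hPd hPi
  -- (7) values: soundness of the calculus on the floor relation and on the empty reps; exchange of carriers
  have hBalg : IsAlgebraic ℚ B :=
    (isAlgebraic_endpoints_of_isSemialgebraic_Ioo hB1 (hBd ▸ rB.isSemialgebraic_domain)).2
  have hv₀ : rB₀.value = Real.log B₀ := logRep_value hB₀1.le rB₀ hrB₀d hrB₀i
  have hv : rB.value = Real.log B := logRep_value hB1.le rB hBd hBi
  have hvIQ : rIQ.value = 0 := by
    have h1 := KZ.relations_le_ker_eval_holds hIQrel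
    rw [AddMonoidHom.mem_ker] at h1
    simpa only [KZ.eval_of] using h1
  have hvRQ : rRQ.value = 0 := by
    have h1 := KZ.relations_le_ker_eval_holds hRQrel
    rw [AddMonoidHom.mem_ker] at h1
    simpa only [KZ.eval_of] using h1
  have e0 : (q : ℝ) ^ 2 * rIP.value + (p : ℝ) ^ 2 * rP.value - c₀ * Real.log B₀ = 0 := by
    have h1 := KZ.relations_le_ker_eval_holds hmem
    rw [AddMonoidHom.mem_ker] at h1
    simpa only [map_add, map_sub, map_zsmul, KZ.eval_of, zsmul_eq_mul, Int.cast_pow, Int.cast_natCast,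
      hv₀] using h1
  have h4nr : (4 : ℝ) * (n : ℝ) ^ 2 = (g : ℝ) ^ 2 * (q : ℝ) ^ 2 := by
    have := congrArg (fun t : ℤ => (t : ℝ)) h4n
    push_cast at this
    linarith
  have hμ2r : (μ : ℝ) ^ 2 = (g : ℝ) ^ 2 * (p : ℝ) ^ 2 := by exact_mod_cast hμ2
  have hlog : (c : ℝ) * Real.log B + (g : ℝ) ^ 2 * c₀ * Real.log B₀ = 0 := by
    rw [hvIQ, hvRQ, hv, h4nr, hμ2r] at hval
    have : (c : ℝ) * Real.log B = -(g : ℝ) ^ 2 * ((q : ℝ) ^ 2 * rIP.value + (p : ℝ) ^ 2 * rP.value) := by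
      rw [← hval]; ring
    rw [this]
    linear_combination (-(g : ℝ) ^ 2) * e0
  have hsum : ∑ i : Fin 2, (![c, g ^ 2 * c₀] i) • KZ.of ((![rB, rB₀]) i) = c • KZ.of rB + (g ^ 2 * c₀) • KZ.of rB₀ := by
    rw [Fin.sum_univ_two]
    rfl
  have hcar : c • KZ.of rB + (g ^ 2 * c₀) • KZ.of rB₀ ∈ KZ.relations := by
    rw [← hsum]
    refine interval_log_relation_mem_relations 2 (fun _ => (1 : ℝ)) ![B, B₀] ![c, g ^ 2 * c₀] ![rB, rB₀]
      (fun _ => one_pos) (Fin.forall_fin_two.2 ⟨hB1.le, hB₀1.le⟩) (fun _ => isAlgebraic_one)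
      (Fin.forall_fin_two.2 ⟨hBalg, hB₀alg⟩)
      (Fin.forall_fin_two.2
        ⟨⟨hBd, fun t ht => show rB.integrand t = 1 / t 0 by rw [hBi ht, one_div]⟩,
         ⟨hrB₀d, fun t ht => show rB₀.integrand t = 1 / t 0 by rw [hrB₀i ht, one_div]⟩⟩) ?_
    rw [Fin.sum_univ_two]
    simp only [Matrix.cons_val_zero, Matrix.cons_val_one, div_one, Int.cast_mul, Int.cast_pow]
    linear_combination hlog
  -- (8) assemble: `D − c[rB] = 4[rI_Q] + 2μ[rR_Q] − g²·(floor element) − (carrier exchange)`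
  have e : (4 : ℤ) • KZ.of rIQ - ((4 * n ^ 2 : ℕ) : ℤ) • KZ.of rIP + (2 * μ) • KZ.of rRQ - (μ ^ 2) • KZ.of rP
        - c • KZ.of rB
      = (4 : ℤ) • KZ.of rIQ + (2 * μ) • KZ.of rRQ
        - (g ^ 2) • (((q : ℤ) ^ 2) • KZ.of rIP + ((p : ℤ) ^ 2) • KZ.of rP - c₀ • KZ.of rB₀)
        - (c • KZ.of rB + (g ^ 2 * c₀) • KZ.of rB₀) := by
    rw [h4n, hμ2, smul_sub, smul_add, smul_smul, smul_smul, smul_smul, mul_smul (g ^ 2) c₀]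
    abel
  rw [e]
  refine sub_mem (sub_mem (add_mem (AddSubgroup.zsmul_mem _ hIQrel _) (AddSubgroup.zsmul_mem _ hRQrel _))
    (AddSubgroup.zsmul_mem _ hmem _)) hcar

/-- The floor statement, verbatim (`Theses.TorsionLogs.NeronTorsionPrimitiveChain`), for reference. -/
example : Summit.KontsevichZagierPeriods.KontsevichZagierPeriods.Theses.TorsionLogs.NeronTorsionPrimitiveChain :=
  stub_assembly

end Summit.KontsevichZagierPeriods.KontsevichZagierPeriods.Cruxes.TorsionSectorComplete.NeronDistribution.Special
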